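import Summits.CriticalPhenomena.PercolationContinuityZ3.Theorems.PercNearOneGluingNoHeavyLowerTailSahiGridPatternCoCountProductT

/-!
# `NoHeavyLowerTail` (crux stmt-CriticalPhenomena-4575), Sahi programme P1: **CONDITION (N) OF THE CO-COUNT PRODUCT IS MONOTONE IN THE INNER VECTOR** —
# Conjecture A at any inner certificate implies it at the CANONICAL inner vector `λ_V`, and at `(λ_S, λ_V)` the co-count product is `λ_{S×V}` itself

Support file (Sahi cell, seat `prim-sahi-p1`, generation 43; `--supports stmt-CriticalPhenomena-4575`).  Pure proofs, no definitions, no `sorry`, standard axioms.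
Vocabulary of `…SahiGridPattern{,CellForm,DiagCert,DiagCertBlockAndT,CoCountProductT}` (`glue`, `sect`, `ind`, `lamU`, `nuCount`, `freeOf`, `cellOf`).

THE MATHEMATICS (seat memo FROM-prim-sahi-p1-gen43, §1.2).  For `A = S × V ⊆ [3]^{n+k}` and vectors `d_S`, `d_V` the co-count product is
`e(x) = 2^{n+k+1}1_S(ξ)1_V(q) − m_S(ξ)·m_V(q)`, `m_X = 2^{dim+1}1_X − d_X` (`x = glue ξ q`).  Its (N)-budget `e(P∩Q) = Σ_ξ m_S(ξ)·d_V((P∩Q)^ξ) + const` is LINEAR in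
`d_V` with the nonnegative weights `m_S(ξ)` (box `d_S ≤ 2^{n+1}1_S`) on the up-set sections `(P∩Q)^ξ`.  Hence:
* `coProduct_sum_mono_inner` — if `d_V ≼ d_V′` on up-sets (`Σ_W d_V ≤ Σ_W d_V′` for every up-set `W`), then `e_{d_V}(W) ≤ e_{d_V′}(W)` for every up-set `W ⊆ [3]^{n+k}`;
* `diagCert_coProduct_N_mono_inner` — so (N) of the co-count product at a pair of up-sets `(P,Q)` for `(d_S, d_V)` implies (N) there for `(d_S, d_V′)`;
* `diagCert_coProduct_N_canonical_of_cert` — in particular, since every vector with (T) satisfies `d_V ≼ λ_V`, (N) for `(d_S, d_V)` with `d_V` satisfying (T)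
  implies (N) for `(d_S, λ_V)`: **the canonical inner vector `λ_V = 2^{k+1}1_V − ν_V` is the WEAKEST instance of Conjecture A**;
* `coProduct_lamU_lamU` — and at `(λ_S, λ_V)` the co-count product IS `λ_{S×V}` pointwise (`m = ν` multiplies: `ν_{S×V} = ν_S ⊗ ν_V`), so (N) there is exactly
  goodness of `S × V` in its own dimension: the weakest all-`k` form of Conjecture A is "`S` good ∧ `V` good ⇒ `S × V` good".
Nothing in this file asserts Conjecture A or `PatternPos d` for `d ≥ 4`. [this work]
-/

namespace Summit.CriticalPhenomena.PercolationContinuityZ3.Theorems.SahiGridPattern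

open Finset SahiGrid3
open scoped BigOperators

variable {n k : ℕ} {S : Finset (Pd n)} {V : Finset (Pd k)} {A : Finset (Pd (n + k))}

/-- **The co-count budget is `≼`-monotone in the inner vector**: if `Σ_W d_V ≤ Σ_W d_V′` for every up-set `W ⊆ [3]^k` and `d_S ≤ 2^{n+1}1_S` pointwise, then
for every up-set `W ⊆ [3]^{n+k}` the co-count product of `(d_S, d_V)` has at most the mass of that of `(d_S, d_V′)` on `W`. [this work] -/
theorem coProduct_sum_mono_inner (dS : Pd n → ℤ) (hmS : ∀ ξ : Pd n, dS ξ ≤ 2 * (2:ℤ) ^ n * ind S ξ) (dV dV' : Pd k → ℤ)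
    (hle : ∀ W : Finset (Pd k), IsUpperSet (W : Set (Pd k)) → (∑ q ∈ W, dV q) ≤ ∑ q ∈ W, dV' q)
    {W : Finset (Pd (n + k))} (hW : IsUpperSet (W : Set (Pd (n + k)))) :
    (∑ x ∈ W, (2 * (2:ℤ) ^ (n + k) * (ind S (freeOf x) * ind V (cellOf x))
        - (2 * (2:ℤ) ^ n * ind S (freeOf x) - dS (freeOf x)) * (2 * (2:ℤ) ^ k * ind V (cellOf x) - dV (cellOf x))))
      ≤ ∑ x ∈ W, (2 * (2:ℤ) ^ (n + k) * (ind S (freeOf x) * ind V (cellOf x))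
        - (2 * (2:ℤ) ^ n * ind S (freeOf x) - dS (freeOf x)) * (2 * (2:ℤ) ^ k * ind V (cellOf x) - dV' (cellOf x))) := by
  rw [← sub_nonneg, ← Finset.sum_sub_distrib, sum_mem_eq_sum_glue]
  simp only [freeOf_glue, cellOf_glue]
  have hpt : ∀ (ξ : Pd n) (q : Pd k), ind W (glue ξ q) * ((2 * (2:ℤ) ^ (n + k) * (ind S ξ * ind V q)
        - (2 * (2:ℤ) ^ n * ind S ξ - dS ξ) * (2 * (2:ℤ) ^ k * ind V q - dV' q))
        - (2 * (2:ℤ) ^ (n + k) * (ind S ξ * ind V q) - (2 * (2:ℤ) ^ n * ind S ξ - dS ξ) * (2 * (2:ℤ) ^ k * ind V q - dV q)))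
      = (2 * (2:ℤ) ^ n * ind S ξ - dS ξ) * (ind W (glue ξ q) * (dV' q - dV q)) := by
    intro ξ q; ring
  simp only [hpt]
  refine Finset.sum_nonneg fun ξ _ => ?_
  rw [← Finset.mul_sum, sum_ind_glue_mul_eq_sum_sect, Finset.sum_sub_distrib]
  refine mul_nonneg (by linarith [hmS ξ]) ?_
  linarith [hle (sect W ξ) (isUpperSet_sect hW ξ)]

/-- **(N) of the co-count product transfers along `≼` in the inner vector**: (N) at the up-set pair `(P,Q)` for `(d_S, d_V)` implies (N) there for `(d_S, d_V′)`
whenever `d_V ≼ d_V′` on up-sets and `d_S ≤ 2^{n+1}1_S`. [this work] -/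
theorem diagCert_coProduct_N_mono_inner (dS : Pd n → ℤ) (hmS : ∀ ξ : Pd n, dS ξ ≤ 2 * (2:ℤ) ^ n * ind S ξ) (dV dV' : Pd k → ℤ)
    (hle : ∀ W : Finset (Pd k), IsUpperSet (W : Set (Pd k)) → (∑ q ∈ W, dV q) ≤ ∑ q ∈ W, dV' q)
    {P Q : Finset (Pd (n + k))} (hP : IsUpperSet (P : Set (Pd (n + k)))) (hQ : IsUpperSet (Q : Set (Pd (n + k))))
    (hN : (∑ x ∈ P, ∑ y ∈ Q, thetaVal A x y) ≤ ∑ x ∈ P ∩ Q, (2 * (2:ℤ) ^ (n + k) * (ind S (freeOf x) * ind V (cellOf x))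
        - (2 * (2:ℤ) ^ n * ind S (freeOf x) - dS (freeOf x)) * (2 * (2:ℤ) ^ k * ind V (cellOf x) - dV (cellOf x)))) :
    (∑ x ∈ P, ∑ y ∈ Q, thetaVal A x y) ≤ ∑ x ∈ P ∩ Q, (2 * (2:ℤ) ^ (n + k) * (ind S (freeOf x) * ind V (cellOf x))
        - (2 * (2:ℤ) ^ n * ind S (freeOf x) - dS (freeOf x)) * (2 * (2:ℤ) ^ k * ind V (cellOf x) - dV' (cellOf x))) :=
  le_trans hN (coProduct_sum_mono_inner dS hmS dV dV' hle (isUpperSet_inter_coe hP hQ))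

/-- **THE CANONICAL INNER VECTOR IS THE WEAKEST CASE OF CONJECTURE A**: if `d_V` satisfies (T) for `V` (so `d_V ≼ λ_V`) and the co-count product of `(d_S, d_V)`
satisfies (N) at `(P,Q)` (`d_S ≤ 2^{n+1}1_S`), then so does the co-count product of `(d_S, λ_V)`. [this work] -/
theorem diagCert_coProduct_N_canonical_of_cert (dS : Pd n → ℤ) (hmS : ∀ ξ : Pd n, dS ξ ≤ 2 * (2:ℤ) ^ n * ind S ξ) (dV : Pd k → ℤ)
    (hTV : ∀ W : Finset (Pd k), IsUpperSet (W : Set (Pd k)) → (∑ q ∈ W, dV q) ≤ ∑ q ∈ W, lamU V q)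
    {P Q : Finset (Pd (n + k))} (hP : IsUpperSet (P : Set (Pd (n + k)))) (hQ : IsUpperSet (Q : Set (Pd (n + k))))
    (hN : (∑ x ∈ P, ∑ y ∈ Q, thetaVal A x y) ≤ ∑ x ∈ P ∩ Q, (2 * (2:ℤ) ^ (n + k) * (ind S (freeOf x) * ind V (cellOf x))
        - (2 * (2:ℤ) ^ n * ind S (freeOf x) - dS (freeOf x)) * (2 * (2:ℤ) ^ k * ind V (cellOf x) - dV (cellOf x)))) :
    (∑ x ∈ P, ∑ y ∈ Q, thetaVal A x y) ≤ ∑ x ∈ P ∩ Q, (2 * (2:ℤ) ^ (n + k) * (ind S (freeOf x) * ind V (cellOf x))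
        - (2 * (2:ℤ) ^ n * ind S (freeOf x) - dS (freeOf x)) * (2 * (2:ℤ) ^ k * ind V (cellOf x) - lamU V (cellOf x))) :=
  diagCert_coProduct_N_mono_inner dS hmS dV (lamU V) hTV hP hQ hN

/-- **At `(λ_S, λ_V)` the co-count product is `λ_{S×V}` pointwise** (the virtual counts `m = ν` multiply like the true ones: `ν_{S×V}(glue ξ q) = ν_S(ξ)·ν_V(q)`);
so (N) of the co-count product at `(λ_S, λ_V)` is literally goodness of `S × V` in its own dimension. [this work] -/
theorem coProduct_lamU_lamU (hA : ∀ ξ z, glue ξ z ∈ A ↔ (ξ ∈ S ∧ z ∈ V)) (ξ : Pd n) (q : Pd k) :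
    (2 * (2:ℤ) ^ (n + k) * (ind S ξ * ind V q)
        - (2 * (2:ℤ) ^ n * ind S ξ - lamU S ξ) * (2 * (2:ℤ) ^ k * ind V q - lamU V q)) = lamU A (glue ξ q) := by
  rw [lamU_blockAnd hA ξ q]
  unfold lamU
  ring

end Summit.CriticalPhenomena.PercolationContinuityZ3.Theorems.SahiGridPattern
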